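import Literature.Barriers.RiemannHypothesis.LindelofBacklund
import Literature.NumberTheory.LFunctions.LindelofMuConvexity
import Literature.NumberTheory.LFunctions.NymanBeurlingDirichlet
import HarnessLib

/-!
# Discharge of `Titchmarsh1986_thm13_2` (Titchmarsh, Theorem 13.2, condition (13.2.1); Hardy–Littlewood 1923)

Sibling of `Literature/Barriers/RiemannHypothesis/LindelofBacklund.lean` (barrier `LindelofBacklund`),
which vendors, next to Theorem 13.5, the named fact
`Literature.Barriers.RiemannHypothesis.Titchmarsh1986_thm13_2`: the Lindelöf hypothesis
(`Literature.NumberTheory.LFunctions.LindelofHypothesis`, `ζ(1/2 + it) = O(t^ε)`) holds if and only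
if `(1/T)∫₁^T |ζ(1/2 + it)|^{2k} dt = O(T^ε)` for every `k = 1, 2, …` and every `ε > 0`
(Titchmarsh, *The Theory of the Riemann Zeta-Function*, 2nd ed., Theorem 13.2, (13.2.1); Hardy and
Littlewood (5)). This file PROVES it (`Titchmarsh1986_thm13_2_holds`), following the printed proof
(§13.2, p. 329 of the printed book; chunk 241 of the held copy):

* necessity ("The necessity of the condition is obvious"): the uniform Lindelöf bound
  `‖ζ(s)‖ ≤ C (Im s)^{ε/2k}` on `Re s ≥ 1/2`, `Im s ≥ T₀`
  (`Literature.NumberTheory.LFunctions.norm_riemannZeta_le_mul_rpow_of_lindelof`,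
  `LindelofMuConvexity.lean`) and compactness on `[1, T₀]` give `|ζ(1/2+it)|^{2k} ≤ M^{2k} T^ε` on
  `[1, T]` (continuity on the line: `continuous_riemannZeta_line`, `NymanBeurlingDirichlet.lean`),
  whence `(1/T)∫₁^T ≤ M^{2k} T^ε` (`Thm13_2.isBigO_criticalMoment_of_lindelof`);
* sufficiency (Titchmarsh's argument): "on differentiating (2.1.4) we obtain, for `t ≥ 1`,
  `|ζ'(1/2+it)| < Et`" — here `E = 48`, by Cauchy's estimate on the circle of radius `1/4` about
  `1/2 + it` (Mathlib `Complex.norm_deriv_le_of_forall_mem_sphere_norm_le`) and Titchmarsh (2.12.2)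
  (`Literature.NumberTheory.LFunctions.norm_riemannZeta_le_of_re_pos`,
  `ZetaFractionalPartIntegral.lean`), `Thm13_2.norm_deriv_zeta_half_line_le`; hence if
  `|ζ(1/2+it)| > t^ε` then `|ζ(1/2+iu)| ≥ t^ε/2` for `t ≤ u ≤ t + 1/(384t)` (mean value
  inequality, `Thm13_2.norm_zeta_sub_le`), so `∫₁^{t+1} |ζ(1/2+iu)|^{2k} du ≥ (t^ε/2)^{2k}/(384t)`,
  while (13.2.1) with exponent `1` gives `≤ C(t+1)²`; for `2kε ≥ 4` this forces
  `t ≤ 1536·C·4^k`, "which is contrary to hypothesis if `k` is large enough" — the failure of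
  `ζ(1/2+it) = O(t^ε)` supplies such `t` beyond every bound
  (`Thm13_2.lindelof_of_isBigO_criticalMoment`).

Everything is proved from Mathlib and the tree; no named facts are used.

## References

* E. C. Titchmarsh, *The Theory of the Riemann Zeta-Function*, 2nd ed. revised by
  D. R. Heath-Brown, Oxford 1986: Theorem 13.2 and its proof, §13.2 (p. 329; chunk 241 of the held
  copy `book:titchmarsh1986-theory-riemann-zeta-function-2nd-ed-revised`), (2.1.4), (2.12.2).
  [cite: Titchmarsh1986, Theorem 13.2]
* G. H. Hardy, J. E. Littlewood, *On Lindelöf's hypothesis concerning the Riemann zeta-function*,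
  Proc. Royal Soc. A 103 (1923), 403–412 (Titchmarsh's Hardy and Littlewood (5); cited through
  Titchmarsh, not read).
-/

noncomputable section

open Complex Filter Asymptotics Set Metric
open MeasureTheory (volume)

namespace Literature.Barriers.RiemannHypothesis

open Literature.NumberTheory.LFunctions

namespace Thm13_2

/-- Continuity of the moment integrand `‖ζ(1/2 + it)‖^{2k}` (the critical line misses the pole;
`continuous_riemannZeta_line` of `NymanBeurlingDirichlet.lean`). [folklore] -/
theorem continuous_norm_zeta_pow (k : ℕ) :
    Continuous fun t : ℝ ↦ ‖riemannZeta (1 / 2 + t * I)‖ ^ (2 * k) :=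
  (continuous_riemannZeta_line.norm).pow _

/-- Unfolding of `criticalMoment`. [folklore] -/
theorem criticalMoment_eq (k : ℕ) (T : ℝ) :
    criticalMoment k T = T⁻¹ * ∫ t in (1 : ℝ)..T, ‖riemannZeta (1 / 2 + t * I)‖ ^ (2 * k) := rfl

/-! ### Necessity: LH implies (13.2.1) ("The necessity of the condition is obvious.") -/

/-- LH implies `(1/T)∫₁^T |ζ(1/2+it)|^{2k} dt = O(T^ε)`. [cite: Titchmarsh1986, Theorem 13.2] -/
theorem isBigO_criticalMoment_of_lindelof (hLH : LindelofHypothesis) {k : ℕ} (hk : 1 ≤ k)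
    {ε : ℝ} (hε : 0 < ε) : (criticalMoment k) =O[atTop] fun T : ℝ ↦ T ^ ε := by
  have hk0 : (0 : ℝ) < 2 * k := by
    have : (1 : ℝ) ≤ k := by exact_mod_cast hk
    linarith
  set ε' : ℝ := ε / (2 * k) with hε'
  have hε'0 : 0 < ε' := div_pos hε hk0
  obtain ⟨C, hC, T₀, hT₀, hb⟩ := norm_riemannZeta_le_mul_rpow_of_lindelof hLH hε'0
  obtain ⟨K₀, hK₀⟩ := (isCompact_Icc (a := (1 : ℝ)) (b := T₀)).exists_bound_of_continuousOn
    continuous_riemannZeta_line.continuousOn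
  set M : ℝ := max C K₀ with hM
  have hM0 : 0 < M := lt_max_of_lt_left hC
  have hpt : ∀ t : ℝ, 1 ≤ t → ‖riemannZeta (1 / 2 + t * I)‖ ≤ M * t ^ ε' := by
    intro t ht
    have ht1 : 1 ≤ t ^ ε' := Real.one_le_rpow ht hε'0.le
    rcases le_or_gt T₀ t with hT | hT
    · have := hb (1 / 2 + t * I) (by simp) (by simpa using hT)
      calc ‖riemannZeta (1 / 2 + t * I)‖ ≤ C * (1 / 2 + t * I : ℂ).im ^ ε' := this
        _ = C * t ^ ε' := by simp
        _ ≤ M * t ^ ε' := by gcongr; exact le_max_left _ _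
    · calc ‖riemannZeta (1 / 2 + t * I)‖ ≤ K₀ := hK₀ t ⟨ht, hT.le⟩
        _ ≤ M := le_max_right _ _
        _ ≤ M * t ^ ε' := le_mul_of_one_le_right hM0.le ht1
  have hpow : ∀ t T : ℝ, 1 ≤ t → t ≤ T →
      ‖riemannZeta (1 / 2 + t * I)‖ ^ (2 * k) ≤ M ^ (2 * k) * T ^ ε := by
    intro t T ht htT
    have h0 : 0 ≤ t := by linarith
    calc ‖riemannZeta (1 / 2 + t * I)‖ ^ (2 * k) ≤ (M * t ^ ε') ^ (2 * k) :=
          pow_le_pow_left₀ (norm_nonneg _) (hpt t ht) _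
      _ = M ^ (2 * k) * t ^ ε := by
          rw [mul_pow, ← Real.rpow_mul_natCast h0]
          congr 2
          rw [hε']; push_cast; field_simp
      _ ≤ M ^ (2 * k) * T ^ ε := by
          gcongr
  refine IsBigO.of_bound (M ^ (2 * k)) ?_
  filter_upwards [eventually_ge_atTop (1 : ℝ)] with T hT
  have hT0 : 0 < T := by linarith
  have hint : ∫ t in (1 : ℝ)..T, ‖riemannZeta (1 / 2 + t * I)‖ ^ (2 * k) ≤
      M ^ (2 * k) * T ^ ε * (T - 1) := by
    have := intervalIntegral.integral_mono_on hT
      ((continuous_norm_zeta_pow k).intervalIntegrable (μ := volume) _ _)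
      (continuous_const.intervalIntegrable (μ := volume) _ _) (fun t ht ↦ hpow t T ht.1 ht.2)
    rwa [intervalIntegral.integral_const, smul_eq_mul,
      show (T - 1) * (M ^ (2 * k) * T ^ ε) = M ^ (2 * k) * T ^ ε * (T - 1) by ring] at this
  have hnn : 0 ≤ ∫ t in (1 : ℝ)..T, ‖riemannZeta (1 / 2 + t * I)‖ ^ (2 * k) :=
    intervalIntegral.integral_nonneg hT fun t _ ↦ by positivity
  have hcm0 : 0 ≤ criticalMoment k T := by
    rw [criticalMoment_eq]; exact mul_nonneg (inv_nonneg.mpr hT0.le) hnn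
  rw [Real.norm_of_nonneg hcm0, Real.norm_of_nonneg (Real.rpow_nonneg hT0.le _), criticalMoment_eq]
  have hMk : 0 ≤ M ^ (2 * k) * T ^ ε := by positivity
  calc T⁻¹ * ∫ t in (1 : ℝ)..T, ‖riemannZeta (1 / 2 + t * I)‖ ^ (2 * k)
      ≤ T⁻¹ * (M ^ (2 * k) * T ^ ε * (T - 1)) := by gcongr
    _ ≤ T⁻¹ * (M ^ (2 * k) * T ^ ε * T) := by gcongr; linarith
    _ = M ^ (2 * k) * T ^ ε := by field_simp

/-! ### Sufficiency: Titchmarsh's derivative argument -/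

/-- Points of the closed disc of radius `1/4` about `1/2 + iu` (`u ≥ 1`) have `Re z ≥ 1/4`,
`Im z ≥ 3/4`, and there `‖ζ(z)‖ ≤ 12u` by Titchmarsh (2.12.2)
(`norm_riemannZeta_le_of_re_pos`). [cite: Titchmarsh1986, (2.12.2)] -/
theorem norm_zeta_le_of_near_half_line {u : ℝ} (hu : 1 ≤ u) {z : ℂ}
    (hz : ‖z - (1 / 2 + u * I)‖ ≤ 1 / 4) : z ≠ 1 ∧ ‖riemannZeta z‖ ≤ 12 * u := by
  have hre : 1 / 4 ≤ z.re := by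
    have h := abs_re_le_norm (z - (1 / 2 + u * I))
    have h' : |z.re - 1 / 2| ≤ 1 / 4 := by simpa using h.trans hz
    have := (abs_le.mp h').1
    linarith
  have him : u - 1 / 4 ≤ z.im := by
    have h := abs_im_le_norm (z - (1 / 2 + u * I))
    have h' : |z.im - u| ≤ 1 / 4 := by simpa using h.trans hz
    have := (abs_le.mp h').1
    linarith
  have him' : 3 / 4 ≤ z.im := by linarith
  have hre0 : 0 < z.re := by linarith
  have hz1 : z ≠ 1 := by
    intro h
    rw [h] at him'
    norm_num at him'
  refine ⟨hz1, ?_⟩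
  have hnorm : ‖z‖ ≤ 2 * u := by
    have hc : ‖(1 / 2 : ℂ) + u * I‖ ≤ 1 / 2 + u := by
      calc ‖(1 / 2 : ℂ) + u * I‖ ≤ ‖(1 / 2 : ℂ)‖ + ‖(u : ℂ) * I‖ := norm_add_le _ _
        _ = 1 / 2 + |u| := by simp
        _ = 1 / 2 + u := by rw [abs_of_nonneg (by linarith)]
    calc ‖z‖ = ‖(z - (1 / 2 + u * I)) + (1 / 2 + u * I)‖ := by
          congr 1; ring
      _ ≤ ‖z - (1 / 2 + u * I)‖ + ‖(1 / 2 : ℂ) + u * I‖ := norm_add_le _ _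
      _ ≤ 1 / 4 + (1 / 2 + u) := add_le_add hz hc
      _ ≤ 2 * u := by linarith
  have h1 : 3 / 4 ≤ ‖z - 1‖ := by
    have h := abs_im_le_norm (z - 1)
    have h' : |z.im| ≤ ‖z - 1‖ := by simpa using h
    rw [abs_of_nonneg (by linarith)] at h'
    linarith
  have h0 : 0 ≤ 2 * u := by linarith
  calc ‖riemannZeta z‖ ≤ ‖z‖ / ‖z - 1‖ + ‖z‖ / z.re := norm_riemannZeta_le_of_re_pos hre0 hz1
    _ ≤ (2 * u) / (3 / 4) + (2 * u) / (1 / 4) := by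
        gcongr
    _ = (32 / 3) * u := by ring
    _ ≤ 12 * u := by linarith

/-- **Titchmarsh §13.2: `|ζ'(1/2 + it)| < Et` (`t ≥ 1`)**, here with `E = 48`, by Cauchy's
estimate on the circle of radius `1/4`. [cite: Titchmarsh1986, §13.2] -/
theorem norm_deriv_zeta_half_line_le {u : ℝ} (hu : 1 ≤ u) :
    ‖deriv riemannZeta (1 / 2 + u * I)‖ ≤ 48 * u := by
  have hR : (0 : ℝ) < 1 / 4 := by norm_num
  have hdiff : DiffContOnCl ℂ riemannZeta (ball (1 / 2 + u * I) (1 / 4)) := by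
    refine DifferentiableOn.diffContOnCl ?_
    rw [closure_ball _ hR.ne']
    intro z hz
    rw [mem_closedBall, dist_eq_norm] at hz
    exact (differentiableAt_riemannZeta
      (norm_zeta_le_of_near_half_line hu hz).1).differentiableWithinAt
  have h := Complex.norm_deriv_le_of_forall_mem_sphere_norm_le hR hdiff (C := 12 * u)
    (fun z hz ↦ by
      rw [mem_sphere, dist_eq_norm] at hz
      exact (norm_zeta_le_of_near_half_line hu hz.le).2)
  calc ‖deriv riemannZeta (1 / 2 + u * I)‖ ≤ 12 * u / (1 / 4) := h
    _ = 48 * u := by ring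

/-- The derivative of `y ↦ ζ(1/2 + iy)` along the critical line. [folklore] -/
theorem hasDerivAt_zeta_half_line (u : ℝ) :
    HasDerivAt (fun y : ℝ ↦ riemannZeta (1 / 2 + y * I))
      (deriv riemannZeta (1 / 2 + u * I) * I) u := by
  have h1 : HasDerivAt (fun z : ℂ ↦ 1 / 2 + z * I) I (u : ℂ) := by
    simpa using ((hasDerivAt_id (u : ℂ)).mul_const I).const_add (1 / 2 : ℂ)
  have h2 : HasDerivAt riemannZeta (deriv riemannZeta (1 / 2 + u * I)) (1 / 2 + (u : ℂ) * I) :=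
    (differentiableAt_riemannZeta (one_half_add_ne_one u)).hasDerivAt
  have h3 := (h2.comp (u : ℂ) h1).comp_ofReal
  simpa [Function.comp] using h3

/-- **Titchmarsh §13.2:** `|ζ(1/2+ix) − ζ(1/2+it)| ≤ 2E t |x − t|` for `t ≤ x ≤ t + h ≤ t + 1`,
`t ≥ 1` (mean value inequality with `|ζ'| ≤ 48(t+1) ≤ 96t`). [cite: Titchmarsh1986, §13.2] -/
theorem norm_zeta_sub_le {t h x : ℝ} (ht : 1 ≤ t) (hh1 : h ≤ 1) (hx : x ∈ Icc t (t + h)) :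
    ‖riemannZeta (1 / 2 + x * I) - riemannZeta (1 / 2 + t * I)‖ ≤ 96 * t * (x - t) := by
  have hderiv : ∀ y ∈ Icc t (t + h), HasDerivWithinAt (fun y : ℝ ↦ riemannZeta (1 / 2 + y * I))
      (deriv riemannZeta (1 / 2 + y * I) * I) (Icc t (t + h)) y :=
    fun y _ ↦ (hasDerivAt_zeta_half_line y).hasDerivWithinAt
  have hbound : ∀ y ∈ Ico t (t + h), ‖deriv riemannZeta (1 / 2 + y * I) * I‖ ≤ 96 * t := by
    intro y hy
    have hy1 : 1 ≤ y := ht.trans hy.1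
    rw [norm_mul, Complex.norm_I, mul_one]
    calc ‖deriv riemannZeta (1 / 2 + y * I)‖ ≤ 48 * y := norm_deriv_zeta_half_line_le hy1
      _ ≤ 48 * (t + 1) := by
          gcongr
          linarith [hy.2]
      _ ≤ 96 * t := by linarith
  exact norm_image_sub_le_of_norm_deriv_le_segment' hderiv hbound x hx

/-- **Sufficiency in Theorem 13.2** (Titchmarsh's argument): (13.2.1) for all `k` implies the
Lindelöf hypothesis. [cite: Titchmarsh1986, Theorem 13.2] -/
theorem lindelof_of_isBigO_criticalMoment
    (hmom : ∀ k : ℕ, 1 ≤ k → ∀ ε : ℝ, 0 < ε → (criticalMoment k) =O[atTop] fun T : ℝ ↦ T ^ ε) :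
    LindelofHypothesis := by
  intro ε hε
  refine IsBigO.of_bound 1 ?_
  by_contra hnot
  rw [Filter.not_eventually] at hnot
  -- choose `k` with `2kε ≥ 4`
  obtain ⟨k, hk1, hkε⟩ : ∃ k : ℕ, 1 ≤ k ∧ 4 ≤ 2 * (k : ℝ) * ε := by
    refine ⟨⌈2 / ε⌉₊, ?_, ?_⟩
    · exact Nat.one_le_iff_ne_zero.mpr (Nat.ceil_pos.mpr (by positivity)).ne'
    · have hc : 2 / ε ≤ (⌈2 / ε⌉₊ : ℝ) := Nat.le_ceil (2 / ε)
      calc (4 : ℝ) = 2 * (2 / ε) * ε := by field_simp; ring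
        _ ≤ 2 * (⌈2 / ε⌉₊ : ℝ) * ε := by gcongr
  -- the moment bound with exponent `1`, at `T = t + 1`
  obtain ⟨C, hC, hCM⟩ := (hmom k hk1 1 one_pos).exists_pos
  have hmt : ∀ᶠ t : ℝ in atTop, ‖criticalMoment k (t + 1)‖ ≤ C * ‖(t + 1) ^ (1 : ℝ)‖ :=
    (tendsto_atTop_add_const_right atTop (1 : ℝ) tendsto_id).eventually hCM.bound
  obtain ⟨t, ⟨hbig, hmomt⟩, ht1, htK⟩ := ((hnot.and_eventually hmt).and_eventually
    ((eventually_ge_atTop (1 : ℝ)).and (eventually_gt_atTop (1536 * C * 4 ^ k)))).exists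
  have ht0 : 0 < t := by linarith
  have htε : 1 ≤ t ^ ε := Real.one_le_rpow ht1 hε.le
  -- the large value at `t`
  have hbig' : t ^ ε < ‖riemannZeta (1 / 2 + t * I)‖ := by
    rw [not_le, one_mul, Real.norm_of_nonneg (Real.rpow_nonneg ht0.le _)] at hbig
    exact hbig
  -- the short interval `[t, t + h]`, `h = 1/(384 t)`
  set h : ℝ := 1 / (384 * t) with hh
  have hh0 : 0 < h := by positivity
  have hh1 : h ≤ 1 := by
    rw [hh, div_le_one (by positivity)]; linarith
  have hlow : ∀ x ∈ Icc t (t + h), t ^ ε / 2 ≤ ‖riemannZeta (1 / 2 + x * I)‖ := by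
    intro x hx
    have h1 := norm_zeta_sub_le ht1 hh1 hx
    have h2 : 96 * t * (x - t) ≤ 1 / 4 := by
      calc 96 * t * (x - t) ≤ 96 * t * h := by
            gcongr
            linarith [hx.2]
        _ = 1 / 4 := by rw [hh]; field_simp; norm_num
    have h3 := norm_sub_norm_le (riemannZeta (1 / 2 + t * I)) (riemannZeta (1 / 2 + x * I))
    rw [norm_sub_rev] at h3
    linarith
  -- lower bound for the moment integral over `[1, t + 1]`
  set F : ℝ → ℝ := fun x ↦ ‖riemannZeta (1 / 2 + x * I)‖ ^ (2 * k) with hF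
  have hFc : Continuous F := continuous_norm_zeta_pow k
  have hFnn : ∀ x, 0 ≤ F x := fun x ↦ by rw [hF]; positivity
  have hlower : h * (t ^ ε / 2) ^ (2 * k) ≤ ∫ x in (1 : ℝ)..(t + 1), F x := by
    have hsub : ∫ x in t..(t + h), F x ≤ ∫ x in (1 : ℝ)..(t + 1), F x :=
      intervalIntegral.integral_mono_interval ht1 (by linarith) (by linarith)
        (Eventually.of_forall hFnn) (hFc.intervalIntegrable (μ := volume) _ _)
    have hconst : ∫ x in t..(t + h), (t ^ ε / 2) ^ (2 * k) ≤ ∫ x in t..(t + h), F x :=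
      intervalIntegral.integral_mono_on (by linarith) (continuous_const.intervalIntegrable (μ := volume) _ _)
        (hFc.intervalIntegrable (μ := volume) _ _)
        (fun x hx ↦ pow_le_pow_left₀ (by positivity) (hlow x hx) _)
    rw [intervalIntegral.integral_const, smul_eq_mul, show t + h - t = h by ring] at hconst
    exact hconst.trans hsub
  -- upper bound from the hypothesis
  have hupper : ∫ x in (1 : ℝ)..(t + 1), F x ≤ C * (t + 1) ^ 2 := by
    have ht10 : 0 < t + 1 := by linarith
    have heq : ∫ x in (1 : ℝ)..(t + 1), F x = (t + 1) * criticalMoment k (t + 1) := by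
      rw [criticalMoment_eq, ← mul_assoc, mul_inv_cancel₀ ht10.ne', one_mul]
    rw [heq]
    rw [Real.rpow_one, Real.norm_of_nonneg ht10.le] at hmomt
    calc (t + 1) * criticalMoment k (t + 1) ≤ (t + 1) * ‖criticalMoment k (t + 1)‖ := by
          gcongr; exact Real.le_norm_self _
      _ ≤ (t + 1) * (C * (t + 1)) := by gcongr
      _ = C * (t + 1) ^ 2 := by ring
  -- the exponent: `(t^ε/2)^{2k} ≥ t^4 / 4^k`
  have hexp : t ^ 4 * (1 / 4) ^ k ≤ (t ^ ε / 2) ^ (2 * k) := by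
    have h1 : (t ^ ε / 2) ^ (2 * k) = (t ^ ε) ^ (2 * k) * (1 / 4) ^ k := by
      rw [div_pow, pow_mul (2 : ℝ) 2 k, one_div_pow, div_eq_mul_one_div]
      norm_num
    rw [h1]
    gcongr
    rw [← Real.rpow_mul_natCast ht0.le]
    calc t ^ 4 = t ^ ((4 : ℕ) : ℝ) := (Real.rpow_natCast t 4).symm
      _ ≤ t ^ (ε * ((2 * k : ℕ) : ℝ)) := by
          apply Real.rpow_le_rpow_of_exponent_le ht1
          push_cast
          linarith
  -- combine: `h · t^4 / 4^k ≤ C (t+1)^2 ≤ 4 C t^2`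
  have hchain : h * (t ^ 4 * (1 / 4) ^ k) ≤ 4 * C * t ^ 2 := by
    calc h * (t ^ 4 * (1 / 4) ^ k) ≤ h * (t ^ ε / 2) ^ (2 * k) := by gcongr
      _ ≤ C * (t + 1) ^ 2 := hlower.trans hupper
      _ ≤ C * (2 * t) ^ 2 := by gcongr; linarith
      _ = 4 * C * t ^ 2 := by ring
  -- i.e. `t ≤ 1536 C 4^k`, contradicting the choice of `t`
  have hfin : t ≤ 1536 * C * 4 ^ k := by
    have hq : (1 / 4 : ℝ) ^ k * 4 ^ k = 1 := by rw [← mul_pow]; norm_num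
    have h1 : h * (t ^ 4 * (1 / 4) ^ k) = t * (1 / 4) ^ k * t ^ 2 / 384 := by
      rw [hh]; field_simp
    rw [h1, div_le_iff₀ (by norm_num : (0 : ℝ) < 384)] at hchain
    have ht2 : (0 : ℝ) < t ^ 2 := by positivity
    have h2 : t * (1 / 4) ^ k ≤ 4 * C * 384 := by
      refine le_of_mul_le_mul_right ?_ ht2
      linarith [hchain]
    calc t = t * (1 / 4) ^ k * 4 ^ k := by rw [mul_assoc, hq, mul_one]
      _ ≤ 4 * C * 384 * 4 ^ k := by gcongr
      _ = 1536 * C * 4 ^ k := by ring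
  linarith

end Thm13_2

/-- **Titchmarsh, Theorem 13.2 (Hardy–Littlewood), condition (13.2.1) — PROVED.** The Lindelöf
hypothesis `ζ(1/2 + it) = O(t^ε)` holds if and only if `(1/T)∫₁^T |ζ(1/2 + it)|^{2k} dt = O(T^ε)`
for every `k = 1, 2, …` and every `ε > 0`. Discharge of the named fact `Titchmarsh1986_thm13_2`
of `LindelofBacklund.lean`. [cite: Titchmarsh1986, Theorem 13.2] -/
theorem Titchmarsh1986_thm13_2_holds : Titchmarsh1986_thm13_2 :=
  ⟨fun hLH _ hk _ hε ↦ Thm13_2.isBigO_criticalMoment_of_lindelof hLH hk hε,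
    Thm13_2.lindelof_of_isBigO_criticalMoment⟩

end Literature.Barriers.RiemannHypothesis

end
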